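import Literature.Combinatorics.Optimization.ShellLawLevelStep
import HarnessLib

/-!
# Relabeling: shells, shell counts, shell laws and type counts of a sub-matching are those of a matching on `Fin m`

Setting of `Literature.Combinatorics.Optimization.ShellLawLevelStep` (`ShellStep` namespace): a partner map `π` on `Fin n`,
a `π`-stable ground set `S`, a block `H`, the shells `Shell_S(t,c)`, the counts `Sh_{S,H}(t,c;x)` (`shellCount`) and laws
`law_{S,H}(t,c;x)` (`shellLaw`), the type classes `vAA, vBH, vBN, vDD` and the representatives `reps`
[cite: Rothvoss2017, §2 (PDF pp. 5–6)] [cite: GodsilMeagher2015, §15.2].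

Many smoothness statements of the cell's library are stated for the FULL ground set `univ` of `Fin n` (e.g.
`ShellLawRelativeLevelSmoothness.abs_fwdDiff_iter_shellLaw_le_of_hyps`), while their consumers (cell pnp-psdrank, prover
MEMO-30 §3, eng brick 135) need them for the laws of DELETED ground sets `S ∖ e_v`, `S ∖ e_v ∖ e_w`. This file is the
transport tool: if `f : Fin m ↪ Fin n` intertwines a partner map `π′` on `Fin m` with `π` (`f (π′ i) = π (f i)`) and a block
`H′` with `H` (`i ∈ H′ ↔ f i ∈ H`), then on the image ground set `S = univ.map f`

* §1 `map_mem_shellIn_iff`, **`shellCount_map_eq`**, `card_shellIn_map_eq`, **`shellLaw_map_eq`** — cuts correspond under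
  `U′ ↦ U′.map f` (`half`, cardinalities and block counts are preserved), so `Sh_{S,H}(t,c;x) = Sh_{univ,H′}(t,c;x)` and
  `law_{S,H}(t,c;x) = law_{univ,H′}(t,c;x)`;
* §2 `vAA_map_eq` (& `vBH`, `vBN`, `vDD`), `reps_map_eq` (for STRICTLY MONOTONE `f`: `reps` picks `v < πv`), hence the type
  counts `|reps(vAA)|, |reps(vBH ∪ vBN)|, |reps(vDD)|` agree (`card_reps_vAA_map_eq`, …); `involutive_of_intertwine`,
  `ne_self_of_intertwine` (π′ inherits the matching axioms);
* §3 **`exists_relabel`**: every `π`-stable `S ⊆ Fin n` with `|S| = m` IS such an image — `f = S.orderEmbOfFin` (strictly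
  monotone, `univ.map f = S`) and `π′ = f⁻¹ ∘ π ∘ f`.

Elementary `Finset.map` bookkeeping; all PROVED, 0 sorry, no definitions, no named facts (eng g25, cell pnp-psdrank).
-/

noncomputable section

open Finset

namespace Literature.Combinatorics.Optimization

namespace ShellStep

variable {m n : ℕ} {π : Fin n → Fin n} {π' : Fin m → Fin m} {f : Fin m ↪ Fin n}

/-! ### §1 Cuts, half edges, block counts under `U′ ↦ U′.map f` -/

/-- `half` is transported: `half_π(U′.map f) = (half_{π′} U′).map f`. [cite: Rothvoss2017, §2 (PDF p. 6)] -/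
theorem half_map_eq (hf : ∀ i, f (π' i) = π (f i)) (U' : Finset (Fin m)) :
    half π (U'.map f) = (half π' U').map f := by
  rw [half, half, filter_map]
  congr 1
  ext i
  simp only [mem_filter, Function.comp_apply, ← hf, mem_map' f]

/-- Block counts are transported: `|(U′.map f) ∩ H| = |U′ ∩ H′|`. [cite: Rothvoss2017, §2 (PDF p. 6)] -/
theorem card_map_inter_eq {H : Finset (Fin n)} {H' : Finset (Fin m)} (hH : ∀ i, i ∈ H' ↔ f i ∈ H) (U' : Finset (Fin m)) :
    (U'.map f ∩ H).card = (U' ∩ H').card := by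
  rw [← filter_mem_eq_inter, filter_map, card_map, ← filter_mem_eq_inter]
  congr 1
  ext i
  simp only [mem_filter, Function.comp_apply, hH]

/-- Membership in a shell is transported: `U′.map f ∈ Shell_{univ.map f}(t,c) ↔ U′ ∈ Shell_{univ}(t,c)`.
[cite: Rothvoss2017, §2 (PDF p. 6)] -/
theorem map_mem_shellIn_iff (hf : ∀ i, f (π' i) = π (f i)) (t c : ℕ) (U' : Finset (Fin m)) :
    U'.map f ∈ shellIn π (univ.map f) t c ↔ U' ∈ shellIn π' univ t c := by
  simp only [shellIn, mem_filter, mem_powerset, half_map_eq hf, card_map, map_subset_map, subset_univ, true_and]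

/-- Every subset of the image ground set is an image. [folklore] -/
private theorem exists_eq_map_of_subset {U : Finset (Fin n)} (hU : U ⊆ univ.map f) : ∃ U' : Finset (Fin m), U = U'.map f := by
  obtain ⟨U', -, rfl⟩ := subset_map_iff.1 hU
  exact ⟨U', rfl⟩

/-- **Shell counts are transported**: `Sh_{univ.map f, H}(t,c;x) = Sh_{univ, H′}(t,c;x)`.
[cite: Rothvoss2017, §2 (PDF p. 6)] -/
theorem shellCount_map_eq (hf : ∀ i, f (π' i) = π (f i)) {H : Finset (Fin n)} {H' : Finset (Fin m)}
    (hH : ∀ i, i ∈ H' ↔ f i ∈ H) (t c : ℕ) (x : ℤ) :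
    shellCount π (univ.map f) H t c x = shellCount π' univ H' t c x := by
  rw [shellCount, shellCount]
  congr 1
  symm
  refine card_bij (fun U' _ => U'.map f) (fun U' hU' => ?_) (fun U₁ _ U₂ _ h => map_injective f h) (fun U hU => ?_)
  · rw [mem_filter] at hU' ⊢
    exact ⟨(map_mem_shellIn_iff hf t c U').2 hU'.1, by rw [card_map_inter_eq hH]; exact hU'.2⟩
  · rw [mem_filter] at hU
    obtain ⟨U', rfl⟩ := exists_eq_map_of_subset (f := f) (mem_powerset.1 (mem_filter.1 hU.1).1)
    refine ⟨U', ?_, rfl⟩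
    rw [mem_filter]
    exact ⟨(map_mem_shellIn_iff hf t c U').1 hU.1, by rw [← card_map_inter_eq hH]; exact hU.2⟩

/-- **Shell sizes are transported**: `|Shell_{univ.map f}(t,c)| = |Shell_{univ}(t,c)|`. [cite: Rothvoss2017, §2 (PDF p. 6)] -/
theorem card_shellIn_map_eq (hf : ∀ i, f (π' i) = π (f i)) (t c : ℕ) :
    (shellIn π (univ.map f) t c).card = (shellIn π' univ t c).card := by
  symm
  refine card_bij (fun U' _ => U'.map f) (fun U' hU' => (map_mem_shellIn_iff hf t c U').2 hU')
    (fun U₁ _ U₂ _ h => map_injective f h) (fun U hU => ?_)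
  obtain ⟨U', rfl⟩ := exists_eq_map_of_subset (f := f) (mem_powerset.1 (mem_filter.1 hU).1)
  exact ⟨U', (map_mem_shellIn_iff hf t c U').1 hU, rfl⟩

/-- **Shell laws are transported**: `law_{univ.map f, H}(t,c;x) = law_{univ, H′}(t,c;x)`.
[cite: Rothvoss2017, §2 (PDF p. 6)] -/
theorem shellLaw_map_eq (hf : ∀ i, f (π' i) = π (f i)) {H : Finset (Fin n)} {H' : Finset (Fin m)}
    (hH : ∀ i, i ∈ H' ↔ f i ∈ H) (t c : ℕ) (x : ℤ) :
    shellLaw π (univ.map f) H t c x = shellLaw π' univ H' t c x := by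
  rw [shellLaw, shellLaw, shellCount_map_eq hf hH, card_shellIn_map_eq hf]

/-! ### §2 Type classes, representatives, matching axioms -/

/-- `vAA` is transported. [cite: Rothvoss2017, §2 (PDF p. 5)] -/
theorem vAA_map_eq (hf : ∀ i, f (π' i) = π (f i)) {H : Finset (Fin n)} {H' : Finset (Fin m)}
    (hH : ∀ i, i ∈ H' ↔ f i ∈ H) : vAA π (univ.map f) H = (vAA π' univ H').map f := by
  rw [vAA, vAA, filter_map]
  congr 1
  ext i
  simp only [mem_filter, Function.comp_apply, hH, hf]

/-- `vBH` is transported. [cite: Rothvoss2017, §2 (PDF p. 5)] -/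
theorem vBH_map_eq (hf : ∀ i, f (π' i) = π (f i)) {H : Finset (Fin n)} {H' : Finset (Fin m)}
    (hH : ∀ i, i ∈ H' ↔ f i ∈ H) : vBH π (univ.map f) H = (vBH π' univ H').map f := by
  rw [vBH, vBH, filter_map]
  congr 1
  ext i
  simp only [mem_filter, Function.comp_apply, hH, hf]

/-- `vBN` is transported. [cite: Rothvoss2017, §2 (PDF p. 5)] -/
theorem vBN_map_eq (hf : ∀ i, f (π' i) = π (f i)) {H : Finset (Fin n)} {H' : Finset (Fin m)}
    (hH : ∀ i, i ∈ H' ↔ f i ∈ H) : vBN π (univ.map f) H = (vBN π' univ H').map f := by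
  rw [vBN, vBN, filter_map]
  congr 1
  ext i
  simp only [mem_filter, Function.comp_apply, hH, hf]

/-- `vDD` is transported. [cite: Rothvoss2017, §2 (PDF p. 5)] -/
theorem vDD_map_eq (hf : ∀ i, f (π' i) = π (f i)) {H : Finset (Fin n)} {H' : Finset (Fin m)}
    (hH : ∀ i, i ∈ H' ↔ f i ∈ H) : vDD π (univ.map f) H = (vDD π' univ H').map f := by
  rw [vDD, vDD, filter_map]
  congr 1
  ext i
  simp only [mem_filter, Function.comp_apply, hH, hf]

/-- Representatives (`v < πv`) are transported by a STRICTLY MONOTONE relabeling. [cite: GodsilMeagher2015, §15.2] -/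
theorem reps_map_eq (hf : ∀ i, f (π' i) = π (f i)) (hmono : StrictMono f) (C' : Finset (Fin m)) :
    reps π (C'.map f) = (reps π' C').map f := by
  rw [reps, reps, filter_map]
  congr 1
  ext i
  simp only [mem_filter, Function.comp_apply, ← hf, hmono.lt_iff_lt]

/-- The `HH`-type count is transported. [cite: Rothvoss2017, §2 (PDF p. 5)] -/
theorem card_reps_vAA_map_eq (hf : ∀ i, f (π' i) = π (f i)) (hmono : StrictMono f) {H : Finset (Fin n)} {H' : Finset (Fin m)}
    (hH : ∀ i, i ∈ H' ↔ f i ∈ H) : (reps π (vAA π (univ.map f) H)).card = (reps π' (vAA π' univ H')).card := by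
  rw [vAA_map_eq hf hH, reps_map_eq hf hmono, card_map]

/-- The mixed-type count is transported. [cite: Rothvoss2017, §2 (PDF p. 5)] -/
theorem card_reps_vB_map_eq (hf : ∀ i, f (π' i) = π (f i)) (hmono : StrictMono f) {H : Finset (Fin n)} {H' : Finset (Fin m)}
    (hH : ∀ i, i ∈ H' ↔ f i ∈ H) :
    (reps π (vBH π (univ.map f) H ∪ vBN π (univ.map f) H)).card = (reps π' (vBH π' univ H' ∪ vBN π' univ H')).card := by
  rw [vBH_map_eq hf hH, vBN_map_eq hf hH, ← map_union, reps_map_eq hf hmono, card_map]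

/-- The `H̄H̄`-type count is transported. [cite: Rothvoss2017, §2 (PDF p. 5)] -/
theorem card_reps_vDD_map_eq (hf : ∀ i, f (π' i) = π (f i)) (hmono : StrictMono f) {H : Finset (Fin n)} {H' : Finset (Fin m)}
    (hH : ∀ i, i ∈ H' ↔ f i ∈ H) : (reps π (vDD π (univ.map f) H)).card = (reps π' (vDD π' univ H')).card := by
  rw [vDD_map_eq hf hH, reps_map_eq hf hmono, card_map]

/-- The block size is transported: `|(univ.map f) ∩ H| = |H′|`. [cite: Rothvoss2017, §2 (PDF p. 5)] -/
theorem card_map_univ_inter_eq {H : Finset (Fin n)} {H' : Finset (Fin m)} (hH : ∀ i, i ∈ H' ↔ f i ∈ H) :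
    ((univ : Finset (Fin m)).map f ∩ H).card = H'.card := by
  rw [card_map_inter_eq hH, univ_inter]

/-- `π′` is an involution if `π` is. [cite: GodsilMeagher2015, §15.2] -/
theorem involutive_of_intertwine (hπ : ∀ v, π (π v) = v) (hf : ∀ i, f (π' i) = π (f i)) (i : Fin m) : π' (π' i) = i := by
  apply f.injective
  rw [hf, hf, hπ]

/-- `π′` is fixed-point free if `π` is. [cite: GodsilMeagher2015, §15.2] -/
theorem ne_self_of_intertwine (hπ' : ∀ v, π v ≠ v) (hf : ∀ i, f (π' i) = π (f i)) (i : Fin m) : π' i ≠ i := by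
  intro h
  have := hf i
  rw [h] at this
  exact hπ' (f i) this.symm

/-! ### §3 Every `π`-stable ground set is a relabeled `univ` -/

/-- **Existence of the relabeling.** For a `π`-stable `S ⊆ Fin n` with `|S| = m` there are a strictly monotone embedding
`f : Fin m ↪ Fin n` with `univ.map f = S` and a map `π′` on `Fin m` intertwined with `π` (`f (π′ i) = π (f i)`); the block
`H′ = {i : f i ∈ H}` then satisfies `i ∈ H′ ↔ f i ∈ H` by definition. (`f = S.orderEmbOfFin`, `π′ = f⁻¹ ∘ π ∘ f`.)
[cite: GodsilMeagher2015, §15.2] -/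
theorem exists_relabel {S : Finset (Fin n)} (hS : ∀ v ∈ S, π v ∈ S) (hm : S.card = m) :
    ∃ f : Fin m ↪ Fin n, StrictMono f ∧ (univ : Finset (Fin m)).map f = S ∧
      ∃ π' : Fin m → Fin m, ∀ i, f (π' i) = π (f i) := by
  refine ⟨(S.orderEmbOfFin hm).toEmbedding, (S.orderEmbOfFin hm).strictMono, ?_, ?_⟩
  · exact map_orderEmbOfFin_univ S hm
  · refine ⟨fun i => (S.orderIsoOfFin hm).symm ⟨π (S.orderEmbOfFin hm i), hS _ (orderEmbOfFin_mem S hm i)⟩, fun i => ?_⟩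
    have h := (S.orderIsoOfFin hm).apply_symm_apply ⟨π (S.orderEmbOfFin hm i), hS _ (orderEmbOfFin_mem S hm i)⟩
    have h' := congrArg Subtype.val h
    rw [coe_orderIsoOfFin_apply] at h'
    exact h'

/-- **Transport of a shell law on a sub-ground-set to `univ`** (the form consumers use): for a `π`-stable `S` with `|S| = m`
there are `f`, `π′` as in `exists_relabel` such that, with `H′ = univ.filter (f · ∈ H)`,
`law_{S,H}(t,c;x) = law^{π′}_{univ,H′}(t,c;x)` for all `t, c, x`, the type counts agree and `π′` is a fixed-point-free involution
whenever `π` is. [cite: Rothvoss2017, §2 (PDF p. 6)] [cite: GodsilMeagher2015, §15.2] -/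
theorem exists_relabel_shellLaw (hπ : ∀ v, π (π v) = v) (hπ' : ∀ v, π v ≠ v) {S : Finset (Fin n)}
    (hS : ∀ v ∈ S, π v ∈ S) (hm : S.card = m) (H : Finset (Fin n)) :
    ∃ f : Fin m ↪ Fin n, ∃ π' : Fin m → Fin m,
      (univ : Finset (Fin m)).map f = S ∧ (∀ i, π' (π' i) = i) ∧ (∀ i, π' i ≠ i) ∧
      (∀ t c : ℕ, ∀ x : ℤ, shellLaw π S H t c x = shellLaw π' univ (univ.filter fun i => f i ∈ H) t c x) ∧
      (∀ t c : ℕ, (shellIn π S t c).card = (shellIn π' univ t c).card) ∧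
      (reps π (vAA π S H)).card = (reps π' (vAA π' univ (univ.filter fun i => f i ∈ H))).card ∧
      (reps π (vBH π S H ∪ vBN π S H)).card =
        (reps π' (vBH π' univ (univ.filter fun i => f i ∈ H) ∪ vBN π' univ (univ.filter fun i => f i ∈ H))).card ∧
      (reps π (vDD π S H)).card = (reps π' (vDD π' univ (univ.filter fun i => f i ∈ H))).card ∧
      (S ∩ H).card = (univ.filter fun i : Fin m => f i ∈ H).card := by
  obtain ⟨f, hmono, hfS, π', hf⟩ := exists_relabel hS hm
  have hH : ∀ i, i ∈ (univ.filter fun i : Fin m => f i ∈ H) ↔ f i ∈ H := fun i => by simp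
  refine ⟨f, π', hfS, involutive_of_intertwine hπ hf, ne_self_of_intertwine hπ' hf, fun t c x => ?_, fun t c => ?_, ?_, ?_, ?_, ?_⟩
  · rw [← hfS, shellLaw_map_eq hf hH]
  · rw [← hfS, card_shellIn_map_eq hf]
  · rw [← hfS, card_reps_vAA_map_eq hf hmono hH]
  · rw [← hfS, card_reps_vB_map_eq hf hmono hH]
  · rw [← hfS, card_reps_vDD_map_eq hf hmono hH]
  · rw [← hfS, card_map_univ_inter_eq hH]

end ShellStep

end Literature.Combinatorics.Optimization

end
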